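import Summits.QuantumFields.YangMills.Theorems.BalabanUVNodesN18AtRateRecord13Induction
import Summits.QuantumFields.YangMills.Theorems.BalabanUVNodesN18AtReadingOfRecord13Sep

/-!
# ⁗ (SEPARATION-GUARD) EDITION of `BalabanUVNodesN18AtRateRecord13Induction` (p500153) — seat pub-ymgap-dag-n18-d (N18 = NE5, strategy s2), RE-KEYED on def-T's `Stage13Params.Provisos₁₃Sep` ∕
# `Node00.datumOfRecord₁₃Sep` (`Node00/Record13` v1.2, p501191), RR-2's datum key `Node00.IsDatumOfRecord₁₃CSep` (`Node00/Record13DatumKeySep`, p502881) and dag-n22-e's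
# (T-RATE) layer-B ⁗ homes (`RateReading₁₃Sep`, `RRec₁₃Sep`, `RRec₁₃SepOn`, `readingOfRecord₁₃Sep`, `s_N18_rRec₁₃Sep(On)_iff`, `forall_datumKey₁₃Sep_of_forall_admissible`, `readingOfRecord₁₃Sep_u3`)
#
# WHY (route `route-QuantumFields-BalabanUVNodes` rev 18∕19; director-ym №136–№140, plan g67 KEY-18, dag-lead WORDS-139∕140): print ([Balaban1989LargeFieldII] Thm 1) gives the
# background row only at SEPARATED (2.18)-sequences; def-T ADDED the print-faithful proviso `Provisos₁₃Sep` (deprecate-and-add), the four cruxes were re-minted over it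
# (K3⁗ `SpineGivenEndpointR13Sep` = stmt-QuantumFields-20292), and a theorem binding the OLD proviso cannot be fed from the weaker new one — so every storey typed
# `∀ θ (hP : θ.Provisos₁₃ F N), …` is re-keyed ONCE.  THIS FILE is the twin of this seat's own ‴ module under the token map `Provisos₁₃ ↦ Provisos₁₃Sep` ·
# `datumOfRecord₁₃ ↦ datumOfRecord₁₃Sep` · `IsDatumOfRecord₁₃C ↦ IsDatumOfRecord₁₃CSep` · `RateReading₁₃ ↦ RateReading₁₃Sep` · `RRec₁₃ ↦ RRec₁₃Sep` · `RRec₁₃On ↦ RRec₁₃SepOn` ·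
# `readingOfRecord₁₃ ↦ readingOfRecord₁₃Sep` · `s_N18_rRec₁₃(On)_iff ↦ s_N18_rRec₁₃Sep(On)_iff` · `forall_datumKey₁₃_of_forall_admissible ↦ forall_datumKey₁₃Sep_of_forall_admissible`, and in
# THIS seat's decl names `rRec₁₃ ↦ rRec₁₃Sep`, `readingOfRecord₁₃ ↦ readingOfRecord₁₃Sep`; statements = the ‴ statements under the map, proofs = the ‴ proofs VERBATIM.
# EVERYTHING θ-LEVEL IS UNCHANGED AND NOT RE-DECLARED (`Stage13Params`, `u3OfRecord₁₃`, the per-tuple faces and junctions of the original carry no proviso ∕ key and are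
# IMPORTED BY NAME — this module imports its ‴ original) — here: `n18At_u3OfRecord₁₃_readingAdm_of_inductiveStep`.
# ITEM IDS quoted in the ‴ header below (K3‴ `SpineGivenEndpointR13`, stmt-QuantumFields-19912; K0‴) are ASIDES after rev 18; this file is filed
# `--kind proof --supports stmt-QuantumFields-20292 --as helper` — COUNT-NEUTRAL, no stub closed, N18 NOT discharged, no inhabitant of any ⁗ key claimed (K0⁗ `Record13SepInhabited` OPEN).
#
# ‴ HEADER OF RECORD FOLLOWS (token-mapped; its decl list is this file's, the θ-only names above excepted):
#
# BalabanUVNodes ∕ node N18 = NE5 — THE (STEP) JUNCTION AT THE STAGE-13 HOME AND N18's STATEMENT OF RECORD AT THE CANONICAL ε-SMALL FIELDS, STAGE 13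
# (Track A, DAG node N18 = `T4OutputRate.NE5` :211; cluster K4 «SpineRates», item K3‴ `SpineGivenEndpointR13`; module 18d of seat pub-ymgap-dag-n18-d, strategy s2)

HONEST FRAMING.  Count-neutral kernel bookkeeping (`--supports … --as helper`), composition BY NAME of landed theorems; NE5 is NOT PRINTED and NOT proved;
N18 is NOT discharged; no inhabitant of `IsDatumOfRecord₁₃CSep` is claimed (K0‴ OPEN); the towers and the schema (STEP) are PARAMETERS ∕ HYPOTHESES.  The envelope
tables model the PLAQUETTE half (1.11) of the print's small-field conditions only.

WHY.  Modules 18 ∕ 18b ∕ 18c typed N18's Stage-13 homes (`RRec₁₃Sep 𝔯`, `RRec₁₃SepOn 𝔯 Rg`, n22-e's `readingOfRecord₁₃Sep`) with the junction rows in the unconditional H-layer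
currency (twin of module 12 §3) and the (GEN) currency (twin of module 15).  The K3‴ composer (dag-n27-c XLI, successor triggers (s12)∕(s13)) lists as NOT YET TWINNED
at ₁₃: the (STEP) ∕ inductive currency (module 14, dag-n18-c g4's `…N18HLayerW1Induction`) and the plaquette-small ∕ canonical-envelope instance (modules 13 ∕ 16b,
dag-n18-e's `admTransport_plaqEnvelope_alphaL`).  THIS FILE: (§1) the (STEP) junction at ONE Stage-13 tuple and run length (module 14 §1's θ-free
`n18At_pairingAdm_of_inductiveStep` + `N18AtByName.n18At_mono` + module 18 §1's `Iff.rfl` bundle face) and its family rows at both homes; (§2) N18's statement of record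
AT THE CANONICAL ε-SMALL FIELDS, STAGE 13, in closed form — the table family, thresholds and transport clause pinned by name (`e_{L,α_L}` and the transport of record,
dag-n18-e module 11 read at `θ.toStage12Params` — the clause depends on the tuple only through the cube size `θ.τ9.M`), at the reading of record (pin `rfl`).  Every junction row of 18 ∕ 18b ∕ 18c ∕ §1 applies to these tables verbatim with `hT := fun F θ ↦ admTransport_plaqEnvelope_alphaL F θ.toStage12Params`.

WHAT (all `theorem`, 0 `def`).  §1 ★ `n18At_u3OfRecord₁₃_readingAdm_of_inductiveStep`, ★ `s_N18_rRec₁₃Sep_readingAdm_of_inductiveStep_pin`, `s_N18_rRec₁₃SepOn_readingAdm_of_inductiveStep_pin`.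
§2 ★ `s_N18_readingOfRecord₁₃Sep_plaqEnvelope_iff`.

One finite four-torus programme at fixed `ε`; NOT the continuum limit, NOT OS, NOT a mass gap, NOT Clay.  0 `def`, 0 `sorry`.  Sources (TYPES only): T. Bałaban,
CMP **109** (1987) [Balaban1987RG1] (0.4) p. 253, (0.18) p. 255, (0.24)–(0.25) p. 257, Thm 1 p. 259, (1.11) p. 262, (1.18) p. 263; CMP **116** (1988) [Balaban1988RG2Cluster]
(2.13) p. 14, (2.16)–(2.18) p. 16, Lemma 3 (2.38) p. 20, (2.41) p. 21; CMP **98** (1985) [Balaban1985Averaging] Prop. 1 (51) p. 26; R. Kotecký–D. Preiss, CMP **103** (1986)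
[KoteckyPreiss1986]; CMP **122** (1989) [Balaban1989LargeFieldII] (the record's stage).
-/

noncomputable section

open Set Metric
open scoped Matrix.Norms.L2Operator

namespace YMDAG.N18.W1Reading

open Literature.MathematicalPhysics.QuantumFieldTheory.Balaban1983to89
open Literature.MathematicalPhysics.QuantumFieldTheory.Balaban1983to89.T4Continuum
open Literature.MathematicalPhysics.QuantumFieldTheory.Balaban1983to89.T4OutputRate (Carriers Functional NE5 DecayBound Window)
open Literature.MathematicalPhysics.QuantumFieldTheory.Balaban1983to89.T4InputCauchyRateData (StepModel)
open Literature.MathematicalPhysics.QuantumFieldTheory.Balaban1983to89.B13Resummation (locE)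
open Literature.MathematicalPhysics.QuantumFieldTheory.Balaban1983to89.TreeLengthTorus (TDom tsys torusTreeLen)
open Literature.MathematicalPhysics.QuantumFieldTheory.Balaban1983to89.TreeLengthTorusGeometry (TTouch)
open Literature.MathematicalPhysics.QuantumFieldTheory.Balaban1983to89.B12TreeDecay (K₀)
open Literature.MathematicalPhysics.QuantumFieldTheory.Balaban1983to89.ExpMeanLog (deltaSU)
open Literature.MathematicalPhysics.QuantumFieldTheory.Balaban1983to89.Node00 (Stage12Params Stage13Params IsDatumOfRecord₁₃CSep datumOfRecord₁₃Sep U3Letters₁₁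
  U3Objects₁₁ NE2Objects₁₁ NE3Letters₁₁ prependCoupling MatA ιSU avOfRecord)
open Literature.MathematicalPhysics.QuantumFieldTheory.Balaban1983to89.Node00.Sect2 (domCount domSys CPair ofBackgroundC)
open Literature.MathematicalPhysics.QuantumFieldTheory.Balaban1983to89.Node00.W1 (ReadingData LevelPairing LetterInputs ClusterTower pairOfRecord
  dj_pairOfRecord functionalC functional termC box SpRestr AdmBg)
open Summit.QuantumFields.BalabanUV.T4Continuum.B13Carriers (transportRaw)
open Summit.QuantumFields.BalabanUV.T4Continuum.Spine.NE5
open Summit.QuantumFields.YangMills.BalabanUVNodes.N18AtByName (n18At_mono)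
open YMDAG.N18.HLayer
open YMDAG.UVSplit

variable {N : ℕ} [NeZero N]

section Record

variable (𝔯 : RateReading₁₃Sep N) (Rg : (F : T4Family) → Stage13Params F N → Prop)
  (S : (F : T4Family) → (θ : Stage13Params F N) → (k : ℕ) → ClusterTower (F.P k) (MatA N) θ.τ9.M)
  (sp : (F : T4Family) → (θ : Stage13Params F N) → (k j : ℕ) → (domSys (F.P k) θ.τ9.M j).Dom → Set (CPair (F.P k) (MatA N)))
  (gauge : (F : T4Family) → (θ : Stage13Params F N) → (k : ℕ) → GaugeField (F.P k) 0 (Node00.SU N) → GaugeField (F.P k) 0 (Node00.SU N) → ℝ)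
  (hg : ∀ (F : T4Family) (θ : Stage13Params F N) (k : ℕ) (U U' : GaugeField (F.P k) 0 (Node00.SU N)), 0 ≤ gauge F θ k U U')
  (T₀ : (F : T4Family) → (θ : Stage13Params F N) → (k : ℕ) → GaugeField (F.P (k + 1)) 0 (Node00.SU N) → GaugeField (F.P k) 0 (Node00.SU N))
  (hT : ∀ (F : T4Family) (θ : Stage13Params F N) (k : ℕ) (U : GaugeField (F.P (k + 1)) 0 (Node00.SU N)),
    (∀ (j : ℕ) (Y : (domSys (F.P (k + 1)) θ.τ9.M j).Dom), ofBackgroundC (ιSU N) U ∈ sp F θ (k + 1) j Y) →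
      ∀ (j : ℕ) (X : (domSys (F.P k) θ.τ9.M j).Dom), ofBackgroundC (ιSU N) (T₀ F θ k U) ∈ sp F θ k j X)
  (li : (F : T4Family) → Stage13Params F N → LetterInputs)
  (hpin : ∀ (F : T4Family) (θ : Stage13Params F N) (hP : θ.Provisos₁₃Sep F N) (g₀ : ℕ → ℝ) (os : List (ULoop F)),
    (𝔯.lit F θ hP g₀ os).u3 = (ReadingData.ofRecordAdm F θ.τ9.M N (S F θ) (sp F θ) (gauge F θ) (hg F θ) (T₀ F θ) (hT F θ) (li F θ)).u3Objects θ.γ)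

include hpin in
open Classical in
/-- ★ **THE (STEP) ROW AT THE STAGE-13 HOME** [bookkeeping; §1 at every admissible Stage-13 tuple with provisos and every run length, module 18's
`s_N18_rRec₁₃Sep_of_forall_admissible_pin`] — the ₁₃ twin of module 14 §2, for any reading pinned to the admissible reading family.
[cite: Balaban1987RG1, Thm 1 p.259 and (1.18) p.263; Balaban1988RG2Cluster, (2.13) p.14, (2.16)–(2.18) p.16, Lemma 3 (2.38) p.20 and (2.41) p.21; KoteckyPreiss1986, Thm 1 p.492] -/
theorem s_N18_rRec₁₃Sep_readingAdm_of_inductiveStep_pin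
    (h : ∀ (F : T4Family) (θ : Stage13Params F N), θ.Provisos₁₃Sep F N → θ.Admissible F N → ∀ k : ℕ,
      ∃ (Op : Type) (_ : NormedAddCommGroup Op) (_ : NormedSpace ℂ Op) (Hist : Type) (_ : NormedAddCommGroup Hist) (_ : NormedSpace ℂ Hist)
        (Mb : ℝ → StepModel (LevelPairing.ofRecordAdm F θ.τ9.M N k (sp F θ) (gauge F θ k) (hg F θ k) (T₀ F θ k) (hT F θ k)).carriers Op Hist)
        (act : ℝ → (j : ℕ) → Op × Hist → TDom 4 (domCount (F.P k) θ.τ9.M j) → ℂ) (γ' C3 ε₁ Rd κ A_A A_B E_A E_B E₁ δ δ' θr θ' cH ω ρ₀ B : ℝ)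
        (k₀ : ℕ),
        (∀ b : ℝ, 0 < b → b ≤ γ' → ∀ (X : Node00.W1.Dom (F.P k) θ.τ9.M) (z : Op × Hist),
          (Mb b).Out X.1 z.1 z.2 X =
            locE (TTouch (d := 4) (N := domCount (F.P k) θ.τ9.M X.1)) (fun Z : (tsys 4 (domCount (F.P k) θ.τ9.M X.1)).Dom => Z.1)
              (act b X.1 z) X.2.1) ∧
        0 ≤ C3 ∧ 0 ≤ ε₁ ∧ 0 ≤ κ ∧ κ + 2 * (64 * Real.log 162) + 2 ≤ Rd ∧
        C3 * ε₁ * Real.exp (5 * κ + 1) * K₀ 64 8 * 9 * 64 ≤ 1 ∧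
        (∀ b : ℝ, 0 < b → b ≤ γ' → ∀ j, ∀ g ∈ Window γ',
          ∀ (U : (LevelPairing.ofRecordAdm F θ.τ9.M N k (sp F θ) (gauge F θ k) (hg F θ k) (T₀ F θ k) (hT F θ k)).BgB) (q : Op × Hist),
          q ∈ (Mb b).Base j g U →
          ∃ V : Set (Op × Hist), IsOpen V ∧ (Mb b).box j q ⊆ V ∧
            (∀ Z : TDom 4 (domCount (F.P k) θ.τ9.M j), DifferentiableOn ℂ (fun z : Op × Hist => act b j z Z) V) ∧
            (∀ z ∈ V, ∀ Z : TDom 4 (domCount (F.P k) θ.τ9.M j), ‖act b j z Z‖ ≤ C3 * ε₁ * Real.exp (-(Rd * torusTreeLen Z.1)))) ∧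
        (∀ b : ℝ, 0 < b → b ≤ γ' → L01 (Mb b)
          ((LevelPairing.ofRecordAdm F θ.τ9.M N k (sp F θ) (gauge F θ k) (hg F θ k) (T₀ F θ k) (hT F θ k)).EA (S F θ k)) (Window γ')) ∧
        (∀ b : ℝ, 0 < b → b ≤ γ' → L02 (Mb b)
          ((LevelPairing.ofRecordAdm F θ.τ9.M N k (sp F θ) (gauge F θ k) (hg F θ k) (T₀ F θ k) (hT F θ k)).EB (S F θ (k + 1)) b)
          (Window γ')) ∧
        (∀ b : ℝ, 0 < b → b ≤ γ' → L03 (Mb b)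
          ((LevelPairing.ofRecordAdm F θ.τ9.M N k (sp F θ) (gauge F θ k) (hg F θ k) (T₀ F θ k) (hT F θ k)).EB (S F θ (k + 1)) b)
          (Window γ')) ∧
        (∀ b : ℝ, 0 < b → b ≤ γ' → L07 (Mb b) (Window γ') δ θr) ∧
        (∀ b : ℝ, 0 < b → b ≤ γ' → L08 (Mb b) (Window γ') κ (Real.exp 1 * 9 * 64 * K₀ 64 8 ^ 2 * A_B) δ' θr) ∧
        (∀ b : ℝ, 0 < b → b ≤ γ' → L09aff (Mb b) (Window γ')) ∧ (∀ b : ℝ, 0 < b → b ≤ γ' → L09blind (Mb b) (Window γ')) ∧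
        (∀ b : ℝ, 0 < b → b ≤ γ' → L09hom (Mb b) (Window γ')) ∧ (∀ b : ℝ, 0 < b → b ≤ γ' → L09unit (Mb b) (Window γ') κ E₁ cH ω) ∧
        0 < E₁ ∧ 0 ≤ δ + δ' ∧ 0 ≤ θr ∧ θr ≤ θ' ∧ θ' ≤ 1 ∧ 0 ≤ cH ∧ 0 < ω ∧ ρ₀ < 1 ∧
        (δ + δ') * θr ^ k₀ +
            cH * (Real.exp 1 * 9 * 64 * K₀ 64 8 ^ 2 * A_A + Real.exp 1 * 9 * 64 * K₀ 64 8 ^ 2 * A_B) / (1 - ω) ≤ ρ₀ ∧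
        0 ≤ B ∧ (∀ k < k₀, Real.exp 1 * 9 * 64 * K₀ 64 8 ^ 2 * A_A + Real.exp 1 * 9 * 64 * K₀ 64 8 ^ 2 * A_B ≤ B * θr ^ k) ∧
        Real.exp 1 * 9 * 64 * K₀ 64 8 ^ 2 * C3 * cH * ε₁ < (θ' - ω) * (1 - ρ₀) ∧
        (∀ m, SpRestr (sp F θ k (m + 1))) ∧
        (∀ m : ℕ,
          (∀ g ∈ Window γ', ∀ j ≤ m, ∀ (X : (domSys (F.P k) θ.τ9.M j).Dom), ∀ φ ∈ sp F θ k j X,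
              ‖termC (S F θ k) j X g φ‖ ≤ E_A * Real.exp (-(κ * (domSys (F.P k) θ.τ9.M j).dj X))) →
          (∀ g ∈ Window γ', ∀ j ≤ m, ∀ (X : (domSys (F.P k) θ.τ9.M j).Dom), AnalyticOnNhd ℂ (termC (S F θ k) j X g) (sp F θ k j X)) →
          (S F θ k m).AnalyticH (box γ' m) (sp F θ k (m + 1)) ∧ (S F θ k m).Bound238 (box γ' m) (sp F θ k (m + 1)) A_A Rd) ∧
        0 ≤ A_A ∧ A_A * Real.exp (5 * κ + 1) * K₀ 64 8 * 9 * 64 < 1 ∧ Real.exp 1 * 9 * 64 * K₀ 64 8 ^ 2 * A_A ≤ E_A ∧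
        (∀ m, SpRestr (sp F θ (k + 1) (m + 1))) ∧
        (∀ m : ℕ,
          (∀ g ∈ Window γ', ∀ j ≤ m, ∀ (Y : (domSys (F.P (k + 1)) θ.τ9.M j).Dom), ∀ φ ∈ sp F θ (k + 1) j Y,
              ‖termC (S F θ (k + 1)) j Y g φ‖ ≤ E_B * Real.exp (-(κ * (domSys (F.P (k + 1)) θ.τ9.M j).dj Y))) →
          (∀ g ∈ Window γ', ∀ j ≤ m, ∀ (Y : (domSys (F.P (k + 1)) θ.τ9.M j).Dom),
              AnalyticOnNhd ℂ (termC (S F θ (k + 1)) j Y g) (sp F θ (k + 1) j Y)) →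
          (S F θ (k + 1) m).AnalyticH (box γ' m) (sp F θ (k + 1) (m + 1)) ∧
            (S F θ (k + 1) m).Bound238 (box γ' m) (sp F θ (k + 1) (m + 1)) A_B Rd) ∧
        0 ≤ A_B ∧ A_B * Real.exp (5 * κ + 1) * K₀ 64 8 * 9 * 64 < 1 ∧ Real.exp 1 * 9 * 64 * K₀ 64 8 ^ 2 * A_B ≤ E_B ∧
        θ.γ ≤ γ' ∧ (li F θ).κ ≤ κ ∧ θ' ≤ (li F θ).θ₅ ∧
        (Real.exp 1 * 9 * 64 * K₀ 64 8 ^ 2 * (C3 * ε₁) / (1 - ρ₀) * (δ + δ') + B) * (θ' - ω) /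
            (θ' - (ω + Real.exp 1 * 9 * 64 * K₀ 64 8 ^ 2 * (C3 * ε₁) / (1 - ρ₀) * cH)) ≤ (li F θ).C₅) :
    S_N18 (RRec₁₃Sep 𝔯) :=
  s_N18_rRec₁₃Sep_of_forall_admissible_pin 𝔯 _ hpin fun F θ hP hA k =>
    n18At_u3OfRecord₁₃_readingAdm_of_inductiveStep θ k (S F θ) (sp F θ) (gauge F θ) (hg F θ) (T₀ F θ) (hT F θ) (li F θ) (h F θ hP hA k)

include hpin in
open Classical in
/-- **THE (STEP) ROW AT THE REGIME-RESTRICTED HOME** [bookkeeping; §1 under the guard, layer B's `s_N18_rRec₁₃SepOn_iff`]: the data asked only of the admissible tuples with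
provisos IN `Rg` ⟹ `S_N18 (RRec₁₃SepOn 𝔯 Rg)`. [cite: Balaban1987RG1, Thm 1 p.259 and (1.18) p.263; Balaban1988RG2Cluster, (2.13) p.14 and Lemma 3 (2.38) p.20] -/
theorem s_N18_rRec₁₃SepOn_readingAdm_of_inductiveStep_pin
    (h : ∀ (F : T4Family) (θ : Stage13Params F N), θ.Provisos₁₃Sep F N → Rg F θ → θ.Admissible F N → ∀ k : ℕ,
      ∃ (Op : Type) (_ : NormedAddCommGroup Op) (_ : NormedSpace ℂ Op) (Hist : Type) (_ : NormedAddCommGroup Hist) (_ : NormedSpace ℂ Hist)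
        (Mb : ℝ → StepModel (LevelPairing.ofRecordAdm F θ.τ9.M N k (sp F θ) (gauge F θ k) (hg F θ k) (T₀ F θ k) (hT F θ k)).carriers Op Hist)
        (act : ℝ → (j : ℕ) → Op × Hist → TDom 4 (domCount (F.P k) θ.τ9.M j) → ℂ) (γ' C3 ε₁ Rd κ A_A A_B E_A E_B E₁ δ δ' θr θ' cH ω ρ₀ B : ℝ)
        (k₀ : ℕ),
        (∀ b : ℝ, 0 < b → b ≤ γ' → ∀ (X : Node00.W1.Dom (F.P k) θ.τ9.M) (z : Op × Hist),
          (Mb b).Out X.1 z.1 z.2 X =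
            locE (TTouch (d := 4) (N := domCount (F.P k) θ.τ9.M X.1)) (fun Z : (tsys 4 (domCount (F.P k) θ.τ9.M X.1)).Dom => Z.1)
              (act b X.1 z) X.2.1) ∧
        0 ≤ C3 ∧ 0 ≤ ε₁ ∧ 0 ≤ κ ∧ κ + 2 * (64 * Real.log 162) + 2 ≤ Rd ∧
        C3 * ε₁ * Real.exp (5 * κ + 1) * K₀ 64 8 * 9 * 64 ≤ 1 ∧
        (∀ b : ℝ, 0 < b → b ≤ γ' → ∀ j, ∀ g ∈ Window γ',
          ∀ (U : (LevelPairing.ofRecordAdm F θ.τ9.M N k (sp F θ) (gauge F θ k) (hg F θ k) (T₀ F θ k) (hT F θ k)).BgB) (q : Op × Hist),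
          q ∈ (Mb b).Base j g U →
          ∃ V : Set (Op × Hist), IsOpen V ∧ (Mb b).box j q ⊆ V ∧
            (∀ Z : TDom 4 (domCount (F.P k) θ.τ9.M j), DifferentiableOn ℂ (fun z : Op × Hist => act b j z Z) V) ∧
            (∀ z ∈ V, ∀ Z : TDom 4 (domCount (F.P k) θ.τ9.M j), ‖act b j z Z‖ ≤ C3 * ε₁ * Real.exp (-(Rd * torusTreeLen Z.1)))) ∧
        (∀ b : ℝ, 0 < b → b ≤ γ' → L01 (Mb b)
          ((LevelPairing.ofRecordAdm F θ.τ9.M N k (sp F θ) (gauge F θ k) (hg F θ k) (T₀ F θ k) (hT F θ k)).EA (S F θ k)) (Window γ')) ∧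
        (∀ b : ℝ, 0 < b → b ≤ γ' → L02 (Mb b)
          ((LevelPairing.ofRecordAdm F θ.τ9.M N k (sp F θ) (gauge F θ k) (hg F θ k) (T₀ F θ k) (hT F θ k)).EB (S F θ (k + 1)) b)
          (Window γ')) ∧
        (∀ b : ℝ, 0 < b → b ≤ γ' → L03 (Mb b)
          ((LevelPairing.ofRecordAdm F θ.τ9.M N k (sp F θ) (gauge F θ k) (hg F θ k) (T₀ F θ k) (hT F θ k)).EB (S F θ (k + 1)) b)
          (Window γ')) ∧
        (∀ b : ℝ, 0 < b → b ≤ γ' → L07 (Mb b) (Window γ') δ θr) ∧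
        (∀ b : ℝ, 0 < b → b ≤ γ' → L08 (Mb b) (Window γ') κ (Real.exp 1 * 9 * 64 * K₀ 64 8 ^ 2 * A_B) δ' θr) ∧
        (∀ b : ℝ, 0 < b → b ≤ γ' → L09aff (Mb b) (Window γ')) ∧ (∀ b : ℝ, 0 < b → b ≤ γ' → L09blind (Mb b) (Window γ')) ∧
        (∀ b : ℝ, 0 < b → b ≤ γ' → L09hom (Mb b) (Window γ')) ∧ (∀ b : ℝ, 0 < b → b ≤ γ' → L09unit (Mb b) (Window γ') κ E₁ cH ω) ∧
        0 < E₁ ∧ 0 ≤ δ + δ' ∧ 0 ≤ θr ∧ θr ≤ θ' ∧ θ' ≤ 1 ∧ 0 ≤ cH ∧ 0 < ω ∧ ρ₀ < 1 ∧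
        (δ + δ') * θr ^ k₀ +
            cH * (Real.exp 1 * 9 * 64 * K₀ 64 8 ^ 2 * A_A + Real.exp 1 * 9 * 64 * K₀ 64 8 ^ 2 * A_B) / (1 - ω) ≤ ρ₀ ∧
        0 ≤ B ∧ (∀ k < k₀, Real.exp 1 * 9 * 64 * K₀ 64 8 ^ 2 * A_A + Real.exp 1 * 9 * 64 * K₀ 64 8 ^ 2 * A_B ≤ B * θr ^ k) ∧
        Real.exp 1 * 9 * 64 * K₀ 64 8 ^ 2 * C3 * cH * ε₁ < (θ' - ω) * (1 - ρ₀) ∧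
        (∀ m, SpRestr (sp F θ k (m + 1))) ∧
        (∀ m : ℕ,
          (∀ g ∈ Window γ', ∀ j ≤ m, ∀ (X : (domSys (F.P k) θ.τ9.M j).Dom), ∀ φ ∈ sp F θ k j X,
              ‖termC (S F θ k) j X g φ‖ ≤ E_A * Real.exp (-(κ * (domSys (F.P k) θ.τ9.M j).dj X))) →
          (∀ g ∈ Window γ', ∀ j ≤ m, ∀ (X : (domSys (F.P k) θ.τ9.M j).Dom), AnalyticOnNhd ℂ (termC (S F θ k) j X g) (sp F θ k j X)) →
          (S F θ k m).AnalyticH (box γ' m) (sp F θ k (m + 1)) ∧ (S F θ k m).Bound238 (box γ' m) (sp F θ k (m + 1)) A_A Rd) ∧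
        0 ≤ A_A ∧ A_A * Real.exp (5 * κ + 1) * K₀ 64 8 * 9 * 64 < 1 ∧ Real.exp 1 * 9 * 64 * K₀ 64 8 ^ 2 * A_A ≤ E_A ∧
        (∀ m, SpRestr (sp F θ (k + 1) (m + 1))) ∧
        (∀ m : ℕ,
          (∀ g ∈ Window γ', ∀ j ≤ m, ∀ (Y : (domSys (F.P (k + 1)) θ.τ9.M j).Dom), ∀ φ ∈ sp F θ (k + 1) j Y,
              ‖termC (S F θ (k + 1)) j Y g φ‖ ≤ E_B * Real.exp (-(κ * (domSys (F.P (k + 1)) θ.τ9.M j).dj Y))) →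
          (∀ g ∈ Window γ', ∀ j ≤ m, ∀ (Y : (domSys (F.P (k + 1)) θ.τ9.M j).Dom),
              AnalyticOnNhd ℂ (termC (S F θ (k + 1)) j Y g) (sp F θ (k + 1) j Y)) →
          (S F θ (k + 1) m).AnalyticH (box γ' m) (sp F θ (k + 1) (m + 1)) ∧
            (S F θ (k + 1) m).Bound238 (box γ' m) (sp F θ (k + 1) (m + 1)) A_B Rd) ∧
        0 ≤ A_B ∧ A_B * Real.exp (5 * κ + 1) * K₀ 64 8 * 9 * 64 < 1 ∧ Real.exp 1 * 9 * 64 * K₀ 64 8 ^ 2 * A_B ≤ E_B ∧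
        θ.γ ≤ γ' ∧ (li F θ).κ ≤ κ ∧ θ' ≤ (li F θ).θ₅ ∧
        (Real.exp 1 * 9 * 64 * K₀ 64 8 ^ 2 * (C3 * ε₁) / (1 - ρ₀) * (δ + δ') + B) * (θ' - ω) /
            (θ' - (ω + Real.exp 1 * 9 * 64 * K₀ 64 8 ^ 2 * (C3 * ε₁) / (1 - ρ₀) * cH)) ≤ (li F θ).C₅) :
    S_N18 (RRec₁₃SepOn 𝔯 Rg) := by
  rw [s_N18_rRec₁₃SepOn_iff]
  intro F θ hP hRg hA g₀ os k
  rw [hpin]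
  exact n18At_u3OfRecord₁₃_readingAdm_of_inductiveStep θ k (S F θ) (sp F θ) (gauge F θ) (hg F θ) (T₀ F θ) (hT F θ) (li F θ) (h F θ hP hRg hA k)

end Record

/-! ## §2 N18's statement of record at the canonical ε-small fields, Stage 13 (reading of record, pin `rfl`) -/

section Envelope

variable (S : (F : T4Family) → (θ : Stage13Params F N) → (k : ℕ) → ClusterTower (F.P k) (MatA N) θ.τ9.M)
  (gauge : (F : T4Family) → (θ : Stage13Params F N) → (k : ℕ) → GaugeField (F.P k) 0 (Node00.SU N) → GaugeField (F.P k) 0 (Node00.SU N) → ℝ)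
  (hg : ∀ (F : T4Family) (θ : Stage13Params F N) (k : ℕ) (U U' : GaugeField (F.P k) 0 (Node00.SU N)), 0 ≤ gauge F θ k U U')
  (li : (F : T4Family) → Stage13Params F N → LetterInputs) (ℓ₃ : T4Family → NE3Letters₁₁)
  (ne2 : (F : T4Family) → Stage13Params F N → (ℕ → ℝ) → List (ULoop F) → ℕ → NE2Objects₁₁)
  (ne1 : (F : T4Family) → Stage13Params F N → (ℕ → ℝ) → List (ULoop F) → NE1pCarriers)

/-- ★ **N18's STATEMENT OF RECORD AT THE CANONICAL ε-SMALL FIELDS, STAGE 13, IN CLOSED FORM** [bookkeeping; 18b `s_N18_readingOfRecord₁₃Sep_readingAdm_iff` at the canonical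
envelope tables `(k, j, Y) ↦ (ι·, 0) '' {V | PlaqSmall (e_{L,α_L}(ε_k²)) V}` with the transport of record and dag-n18-e's clause `admTransport_plaqEnvelope_alphaL F θ.toStage12Params`
(the clause reads the tuple through `θ.τ9.M` only)]: at n22-e's reading of record over these reading data, `S_N18 (RRec₁₃Sep 𝔯)` ⇔ for every family `F`, Stage-13 datum key
`h` (`θ := h.params`), run length `k`, member `b ∈ ]0, θ.γ]`, history `g ∈ ]0, θ.γ]^ℕ`, every gauge field `U` of the `(k+1)`-th torus with `|∂U − 1| < e_{L,α_L}(ε_{k+1}²)` and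
every run-A domain `(j, X)`: `|Re E^{(j)}_{S_k}(X; g; (ι(M U), 0)) − Re E^{(j+1)}_{S_{k+1}}(πX; b∷g; (ιU, 0))| ≤ C₅ · θ₅ ^ j · e^{−κ·d_j(X)}`, `M` the transport of record.  Every
map ∕ table ∕ threshold pinned by name; residual: the towers `S`, the gauges, the letters, N16's `ℓ₃`, N15's `ne2`, NODE O's `ne1` (the last three not read).  NOT PRINTED;
NOT proved. [cite: Balaban1987RG1, (0.4) p.253, (0.18) p.255, (0.24)–(0.25) p.257, Thm 1 p.259, (1.11) p.262 and (1.18) p.263; Balaban1988RG2Cluster, (2.13) p.14; Balaban1985Averaging, Prop. 1 (51) p.26] -/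
theorem s_N18_readingOfRecord₁₃Sep_plaqEnvelope_iff :
    S_N18 (RRec₁₃Sep (readingOfRecord₁₃Sep (fun F θ => ReadingData.ofRecordAdm F θ.τ9.M N (S F θ)
      (fun (k j : ℕ) (_ : (domSys (F.P k) θ.τ9.M j).Dom) => ofBackgroundC (ιSU N) '' {V : GaugeField (F.P k) 0 (Node00.SU N) |
        PlaqSmall (min ((F.L : ℝ) ^ 2 * ((F.L : ℝ) ^ 2 - 1) / (4 * (143 * ((16 : ℝ) * (F.L : ℝ) ^ 2) ^ 2)))
            (deltaSU (Fin N) / 2 / (32 * (F.L : ℝ) ^ 2)) * F.eps k ^ 2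
          * (1 + 4 * (143 * ((16 : ℝ) * (F.L : ℝ) ^ 2) ^ 2)
            * min ((F.L : ℝ) ^ 2 * ((F.L : ℝ) ^ 2 - 1) / (4 * (143 * ((16 : ℝ) * (F.L : ℝ) ^ 2) ^ 2)))
              (deltaSU (Fin N) / 2 / (32 * (F.L : ℝ) ^ 2))
            / ((F.L : ℝ) ^ 2 * ((F.L : ℝ) ^ 2 - 1)) * F.eps k ^ 2)) V})
      (gauge F θ) (hg F θ) (fun k => transportRaw F k (avOfRecord F N (k + 1) 0)) (admTransport_plaqEnvelope_alphaL F θ.toStage12Params) (li F θ)) ℓ₃ ne2 ne1)) ↔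
      ∀ (F : T4Family) (D : Datum F N) (h : IsDatumOfRecord₁₃CSep F N D) (k : ℕ) (b : ℝ), 0 < b → b ≤ h.params.γ →
        ∀ g ∈ Window h.params.γ, ∀ (U : GaugeField (F.P (k + 1)) 0 (Node00.SU N)),
          PlaqSmall (min ((F.L : ℝ) ^ 2 * ((F.L : ℝ) ^ 2 - 1) / (4 * (143 * ((16 : ℝ) * (F.L : ℝ) ^ 2) ^ 2)))
              (deltaSU (Fin N) / 2 / (32 * (F.L : ℝ) ^ 2)) * F.eps (k + 1) ^ 2
            * (1 + 4 * (143 * ((16 : ℝ) * (F.L : ℝ) ^ 2) ^ 2)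
              * min ((F.L : ℝ) ^ 2 * ((F.L : ℝ) ^ 2 - 1) / (4 * (143 * ((16 : ℝ) * (F.L : ℝ) ^ 2) ^ 2)))
                (deltaSU (Fin N) / 2 / (32 * (F.L : ℝ) ^ 2))
              / ((F.L : ℝ) ^ 2 * ((F.L : ℝ) ^ 2 - 1)) * F.eps (k + 1) ^ 2)) U →
          ∀ X : Node00.W1.Dom (F.P k) h.params.τ9.M,
          |(functionalC (S F h.params k) g (ofBackgroundC (ιSU N) (transportRaw F k (avOfRecord F N (k + 1) 0) U)) X).re -
              (functionalC (S F h.params (k + 1)) (prependCoupling b g) (ofBackgroundC (ιSU N) U) (pairOfRecord F h.params.τ9.M k X)).re| ≤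
            (li F h.params).C₅ * (li F h.params).θ₅ ^ X.1 * Real.exp (-((li F h.params).κ * (domSys (F.P k) h.params.τ9.M X.1).dj X.2)) := by
  rw [s_N18_readingOfRecord₁₃Sep_readingAdm_iff]
  refine forall₅_congr fun F D h k b => forall₂_congr fun hb hbγ => forall₂_congr fun g hgW => ⟨fun H U hU X => ?_, fun H U X => ?_⟩
  · exact H ⟨U, fun j Y => (mem_image_ofBackgroundC_iff _ U).2 hU⟩ X
  · exact H U.1 ((mem_image_ofBackgroundC_iff _ U.1).1 (U.2 0 (Node00.Sect2.cubeDom (F.P (k + 1)) h.params.τ9.M 0 fun _ => 0))) X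

end Envelope

end YMDAG.N18.W1Reading

end
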